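import Summits.ABC.ABC.Theses.IneffectiveSubspace

/-!
# `UniformSadicTowerFour` (stmt-ABC-14937), line `Sketch`: the `K = 2` level-one rung is Hall-hard

The stub `stub_primeHall_of_levelOneTwo` of the line `Sketch` (card `mixed-radical-exchange-map`).

**Statement.** Suppose the LEVEL-ONE RUNG at budget `K = 2` ("uniform Mahler–Ridout with linear
`S`-loss"): for every `ε > 0` there is `C = C(ε) > 0` with
`c < C · ((∏_{p ∈ S} p) · {abc}^S)^(1+ε)` for every abc triple `(a, b, c)` and every set `S` of at
most `2` primes, where `{m}^S := ∏_{r ∣ m, r ∉ S} r^{v_r(m)}` is the `S`-free part of `m`. Then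
Hall's inequality holds for PRIME arguments: for every `ε > 0` there is `C > 0` with
`q^{1/2 − ε} ≤ C · |q³ − p²|` for all primes `p, q` with `q³ ≠ p²`.

**Proof.** Given `ε > 0` put `ε' := min (ε/3) (1/10)`, take `C₀` from the rung at `ε'` and answer
with `C := max C₀ 1`. Fix primes `p, q`.
* `p = q`: `|q³ − q²| = q²(q − 1) ≥ q ≥ q^{1/2−ε}` (`q ≥ 2`), fine since `C ≥ 1`.
* `p ≠ q`, `p² < q³`: the triple `(p², q³ − p², q³)` is an abc triple (coprimality from `p ≠ q`),
  and at `S = {p, q}` its `S`-free part is `≤ b := q³ − p²` (every prime `r ∉ {p, q}` of `abc` has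
  `v_r(abc) = v_r(b)`), so the rung gives `q³ < C₀ · (p · q · b)^{1+ε'}`. Taking logarithms
  (`x = log p`, `y = log q`, `z = log b`, `k = log C ≥ log C₀`, all `≥ 0`) and using `2x ≤ 3y`:
  `3y < k + (1+ε')(5y/2 + z)`, i.e. `(1/2 − 5ε'/2)·y < k + (1+ε')·z`.
* `p ≠ q`, `q³ < p²`: symmetrically the triple `(q³, p² − q³, p²)` at `S = {p, q}` gives
  `2x < k + (1+ε')(x + y + z)` with `3y ≤ 2x`, so `(1/3 − 5ε'/3)·x < k + (1+ε')·z` and, as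
  `ε' ≤ 1/5` and `3y/2 ≤ x`, again `(1/2 − 5ε'/2)·y < k + (1+ε')·z`.
In both mixed cases the endgame is linear: `(1+ε')(1/2 − ε) ≤ 1/2 − 5ε'/2` because
`3ε' ≤ ε ≤ ε + εε'`, so `(1+ε')(1/2−ε)·y ≤ (1/2 − 5ε'/2)·y < k + (1+ε') z ≤ (1+ε')(k + z)`
(`k ≥ 0`); dividing by `1+ε'` gives `(1/2 − ε)·log q ≤ log C + log b`, i.e.
`q^{1/2−ε} ≤ C · b = C · |q³ − p²|`.

Sources: card mixed-radical-exchange-map (crux stmt-ABC-14937, line Sketch); Hall's conjecture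
calibration. Mathlib only (`Nat.factorization_mul`, `Nat.primeFactors_mul`,
`Nat.prod_primeFactors_pow_factorization`, `Finset.prod_pair`, `Finset.card_le_two`,
`Real.log_rpow`, `Real.log_le_log_iff`). Deliberately NOT here: the other stubs of the line (normal
form, `K`-uniform sandwich, places-to-level, the `ω(abc) ≤ 2` corner, the open `stub_core`).
-/

-- `Summit.<Summit>.<Problem>` is the mandated summit-side namespace (CONVENTIONS §2); for the
-- single-conjunct summit `ABC` the two coincide, so the duplicate `ABC.ABC` is deliberate.
set_option linter.dupNamespace false

namespace Summit.ABC.ABC.Theorems.UniformSadicTowerFour.MixedRadical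

open Literature.NumberTheory.DiophantineGeometry (IsABCTriple rad rad_def)
open Summit.ABC.ABC.Theses.IneffectiveSubspace
open scoped BigOperators

/-! ## The linear endgame in logarithmic coordinates -/

/-- The linear endgame: from `(1/2 − 5ε'/2)·y < k + (1+ε')·z` with `y, k ≥ 0`, `0 < ε' ≤ ε/3`,
conclude `(1/2 − ε)·y ≤ k + z` (multiply the target by `1 + ε'` and compare coefficients).
[folklore] -/
theorem primeHall_loglinear {y z k ε ε' : ℝ} (hy : 0 ≤ y) (hk : 0 ≤ k) (hε : 0 < ε)
    (hε'0 : 0 < ε') (hε'1 : ε' ≤ ε / 3)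
    (hs : (1 / 2 - 5 / 2 * ε') * y < k + (1 + ε') * z) :
    (1 / 2 - ε) * y ≤ k + z := by
  have hεε : 0 ≤ ε * ε' := mul_nonneg hε.le hε'0.le
  have h3 : 0 ≤ (ε + ε * ε' - 3 * ε') * y := mul_nonneg (by linarith) hy
  have h4 : 0 ≤ ε' * k := mul_nonneg hε'0.le hk
  have key : (1 + ε') * ((1 / 2 - ε) * y) ≤ (1 + ε') * (k + z) := by linarith
  exact le_of_mul_le_mul_left key (by linarith)

/-- Case `p² ≤ q³` in logarithmic coordinates (`x = log p`, `y = log q`, `z = log b`):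
`3y < k₀ + (1+ε')(x + y + z)` and `2x ≤ 3y` give `(1/2 − 5ε'/2)·y < k + (1+ε')·z` for any `k ≥ k₀`.
[folklore] -/
theorem primeHall_caseA {x y z k₀ k ε' : ℝ} (hk : k₀ ≤ k) (hε'0 : 0 < ε')
    (h1 : 3 * y < k₀ + (1 + ε') * (x + y + z)) (h2 : 2 * x ≤ 3 * y) :
    (1 / 2 - 5 / 2 * ε') * y < k + (1 + ε') * z := by
  have e1 : (1 + ε') * x ≤ (1 + ε') * (3 / 2 * y) :=
    mul_le_mul_of_nonneg_left (by linarith) (by linarith)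
  linarith

/-- Case `q³ ≤ p²` in logarithmic coordinates (`x = log p`, `y = log q`, `z = log b`):
`2x < k₀ + (1+ε')(x + y + z)` and `3y ≤ 2x` give `(1/2 − 5ε'/2)·y < k + (1+ε')·z` for any `k ≥ k₀`,
provided `ε' ≤ 1/10` (so that `1/3 − 5ε'/3 ≥ 0`). [folklore] -/
theorem primeHall_caseB {x y z k₀ k ε' : ℝ} (hk : k₀ ≤ k) (hε'0 : 0 < ε') (hε'2 : ε' ≤ 1 / 10)
    (h1 : 2 * x < k₀ + (1 + ε') * (x + y + z)) (h2 : 3 * y ≤ 2 * x) :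
    (1 / 2 - 5 / 2 * ε') * y < k + (1 + ε') * z := by
  have e1 : (1 + ε') * y ≤ (1 + ε') * (2 / 3 * x) :=
    mul_le_mul_of_nonneg_left (by linarith) (by linarith)
  have e2 : 0 ≤ (1 / 3 - 5 / 3 * ε') * (x - 3 / 2 * y) := mul_nonneg (by linarith) (by linarith)
  linarith

/-- The real-analysis core: for reals `P, Q, B ≥ 1`, constants `0 < C₀ ≤ C₁` with `1 ≤ C₁`, and
`0 < ε' ≤ min (ε/3) (1/10)`, either of the two fed-back rung inequalities
(`Q³ < C₀ (PQB)^{1+ε'}` with `P² ≤ Q³`, or `P² < C₀ (PQB)^{1+ε'}` with `Q³ ≤ P²`) forces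
`Q^{1/2−ε} ≤ C₁ · B` (take logarithms and run the linear endgame). [folklore] -/
theorem primeHall_core {P Q B C₀ C₁ ε ε' : ℝ} (hP : 1 ≤ P) (hQ : 1 ≤ Q) (hB : 1 ≤ B)
    (hC₀ : 0 < C₀) (hC₁ : 1 ≤ C₁) (hC : C₀ ≤ C₁) (hε : 0 < ε) (hε'0 : 0 < ε')
    (hε'1 : ε' ≤ ε / 3) (hε'2 : ε' ≤ 1 / 10)
    (hcase : (Q ^ 3 < C₀ * (P * Q * B) ^ (1 + ε') ∧ P ^ 2 ≤ Q ^ 3) ∨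
      (P ^ 2 < C₀ * (P * Q * B) ^ (1 + ε') ∧ Q ^ 3 ≤ P ^ 2)) :
    Q ^ (1 / 2 - ε) ≤ C₁ * B := by
  have hP0 : 0 < P := by linarith
  have hQ0 : 0 < Q := by linarith
  have hB0 : 0 < B := by linarith
  have hy : 0 ≤ Real.log Q := Real.log_nonneg hQ
  have hk : 0 ≤ Real.log C₁ := Real.log_nonneg hC₁
  have hkk : Real.log C₀ ≤ Real.log C₁ := Real.log_le_log hC₀ hC
  have hPQB : 0 < P * Q * B := by positivity
  have hlogR : Real.log (C₀ * (P * Q * B) ^ (1 + ε')) =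
      Real.log C₀ + (1 + ε') * (Real.log P + Real.log Q + Real.log B) := by
    rw [Real.log_mul hC₀.ne' (Real.rpow_pos_of_pos hPQB _).ne', Real.log_rpow hPQB,
      Real.log_mul (by positivity) hB0.ne', Real.log_mul hP0.ne' hQ0.ne']
  have hs : (1 / 2 - 5 / 2 * ε') * Real.log Q < Real.log C₁ + (1 + ε') * Real.log B := by
    rcases hcase with ⟨h1, h2⟩ | ⟨h1, h2⟩
    · have h1' := Real.log_lt_log (by positivity) h1
      rw [hlogR, Real.log_pow] at h1'
      have h2' := Real.log_le_log (by positivity) h2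
      rw [Real.log_pow, Real.log_pow] at h2'
      push_cast at h1' h2'
      exact primeHall_caseA hkk hε'0 h1' h2'
    · have h1' := Real.log_lt_log (by positivity) h1
      rw [hlogR, Real.log_pow] at h1'
      have h2' := Real.log_le_log (by positivity) h2
      rw [Real.log_pow, Real.log_pow] at h2'
      push_cast at h1' h2'
      exact primeHall_caseB hkk hε'0 hε'2 h1' h2'
  have key := primeHall_loglinear hy hk hε hε'0 hε'1 hs
  rw [← Real.log_le_log_iff (Real.rpow_pos_of_pos hQ0 _) (by positivity), Real.log_rpow hQ0,
    Real.log_mul (by positivity) hB0.ne']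
  exact key

/-! ## The arithmetic feed: the abc triple `(a, c − a, c)` at `S = {p, q}` -/

/-- If `m = u · b` with every prime factor of `u` in `S`, then the `S`-free part of `m` is at most
`b`: off `S` one has `v_r(m) = v_r(b)`, and the primes of `m` off `S` are primes of `b`.
[folklore] -/
theorem primeHall_sfree_le {u b : ℕ} (hu : u ≠ 0) (hb : b ≠ 0) {S : Finset ℕ}
    (huS : u.primeFactors ⊆ S) :
    ∏ r ∈ (u * b).primeFactors \ S, r ^ (u * b).factorization r ≤ b := by
  have hsub : (u * b).primeFactors \ S ⊆ b.primeFactors := by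
    intro r hr
    rw [Finset.mem_sdiff, Nat.primeFactors_mul hu hb, Finset.mem_union] at hr
    rcases hr with ⟨hr | hr, hrS⟩
    · exact absurd (huS hr) hrS
    · exact hr
  have hcongr : ∀ r ∈ (u * b).primeFactors \ S,
      r ^ (u * b).factorization r = r ^ b.factorization r := by
    intro r hr
    have hrS : r ∉ S := (Finset.mem_sdiff.mp hr).2
    have hru : u.factorization r = 0 := by
      by_contra hne
      exact hrS (huS (by rw [← Nat.support_factorization]; exact Finsupp.mem_support_iff.mpr hne))
    rw [Nat.factorization_mul hu hb, Finsupp.add_apply, hru, zero_add]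
  calc ∏ r ∈ (u * b).primeFactors \ S, r ^ (u * b).factorization r
      = ∏ r ∈ (u * b).primeFactors \ S, r ^ b.factorization r := Finset.prod_congr rfl hcongr
    _ ≤ ∏ r ∈ b.primeFactors, r ^ b.factorization r := by
        apply Finset.prod_le_prod_of_subset_of_one_le' hsub
        intro r hr _
        exact Nat.one_le_pow _ _ (Nat.prime_of_mem_primeFactors hr).pos
    _ = b := (Nat.prod_primeFactors_pow_factorization hb).symm

/-- The prime factors of `p ^ i * q ^ j` (`p, q` prime) lie in `{p, q}`. [folklore] -/
theorem primeHall_primeFactors_pow_mul_pow {p q : ℕ} (hp : p.Prime) (hq : q.Prime) (i j : ℕ) :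
    (p ^ i * q ^ j).primeFactors ⊆ {p, q} := by
  intro r hr
  obtain ⟨hr, hdvd, -⟩ := Nat.mem_primeFactors.mp hr
  rcases (Nat.Prime.dvd_mul hr).mp hdvd with h | h
  · have := Nat.prime_eq_prime_of_dvd_pow hr hp h
    simp [this]
  · have := Nat.prime_eq_prime_of_dvd_pow hr hq h
    simp [this]

/-- The arithmetic feed. Let `p ≠ q` be primes and `a < c` coprime naturals whose prime factors lie
in `{p, q}`. Feeding the abc triple `(a, c − a, c)` at `S = {p, q}` into the level-one rung (at a
fixed `ε'` with constant `C₀`) gives `c < C₀ · (p · q · (c − a))^{1+ε'}`: the bracket is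
`(∏_{S} r) · {a(c−a)c}^S ≤ p · q · (c − a)`. [folklore] -/
theorem primeHall_feed {C₀ ε' : ℝ} (hC₀ : 0 < C₀) (hε' : 0 < ε')
    (hh : ∀ S : Finset ℕ, S.card ≤ 2 → (∀ p ∈ S, Nat.Prime p) →
      ∀ a b c : ℕ, IsABCTriple a b c →
        (c : ℝ) < C₀ * ((((∏ p ∈ S, p) *
          ∏ p ∈ (a * b * c).primeFactors \ S, p ^ (a * b * c).factorization p : ℕ) : ℝ)) ^ (1 + ε'))
    {p q a c : ℕ} (hp : p.Prime) (hq : q.Prime) (hpq : p ≠ q) (ha : a ≠ 0)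
    (hac : a < c) (hcop : Nat.Coprime a c) (hS : (a * c).primeFactors ⊆ {p, q}) :
    (c : ℝ) < C₀ * ((p : ℝ) * q * ((c - a : ℕ) : ℝ)) ^ (1 + ε') := by
  have hb : 0 < c - a := Nat.sub_pos_of_lt hac
  have hc : c ≠ 0 := by omega
  have habc : IsABCTriple a (c - a) c :=
    ⟨Nat.pos_of_ne_zero ha, hb, by omega, (Nat.coprime_sub_self_right hac.le).mpr hcop⟩
  have hcard : ({p, q} : Finset ℕ).card ≤ 2 := Finset.card_le_two
  have hprime : ∀ r ∈ ({p, q} : Finset ℕ), r.Prime := by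
    intro r hr
    simp only [Finset.mem_insert, Finset.mem_singleton] at hr
    rcases hr with rfl | rfl <;> assumption
  have key := hh {p, q} hcard hprime a (c - a) c habc
  have hprod : ∏ r ∈ ({p, q} : Finset ℕ), r = p * q := Finset.prod_pair hpq
  have hm : a * (c - a) * c = (a * c) * (c - a) := by ring
  have hU : ∏ r ∈ (a * (c - a) * c).primeFactors \ {p, q}, r ^ (a * (c - a) * c).factorization r ≤
      c - a := by
    rw [hm]
    exact primeHall_sfree_le (mul_ne_zero ha hc) hb.ne' hS
  have hle : ((((∏ r ∈ ({p, q} : Finset ℕ), r) *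
      ∏ r ∈ (a * (c - a) * c).primeFactors \ {p, q}, r ^ (a * (c - a) * c).factorization r : ℕ) :
        ℝ)) ≤ (p : ℝ) * q * ((c - a : ℕ) : ℝ) := by
    rw [hprod]
    have h' : (p * q) *
        ∏ r ∈ (a * (c - a) * c).primeFactors \ {p, q}, r ^ (a * (c - a) * c).factorization r ≤
        p * q * (c - a) := Nat.mul_le_mul_left _ hU
    exact_mod_cast h'
  calc (c : ℝ) < _ := key
    _ ≤ C₀ * ((p : ℝ) * q * ((c - a : ℕ) : ℝ)) ^ (1 + ε') := by
        apply mul_le_mul_of_nonneg_left _ hC₀.le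
        exact Real.rpow_le_rpow (Nat.cast_nonneg _) hle (by linarith)

/-! ## The stub -/

/-- **stub_primeHall_of_levelOneTwo (the place dial is Hall-hard at `K = 2`).** The level-one rung
at budget `2` — `c < C(ε) · ((∏_{p∈S} p) · {abc}^S)^(1+ε)` for all abc triples and all sets `S` of
`≤ 2` primes — implies Hall's inequality for PRIME arguments, `q^{1/2−ε} ≤ C · |q³ − p²|`: feed the
triple `(p², q³ − p², q³)` (or `(q³, p² − q³, p²)`) with `S = {p, q}`, where `{abc}^S = |q³ − p²|`.
[folklore] -/
theorem stub_primeHall_of_levelOneTwo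
    (h : ∀ ε : ℝ, 0 < ε → ∃ C : ℝ, 0 < C ∧ ∀ S : Finset ℕ, S.card ≤ 2 → (∀ p ∈ S, Nat.Prime p) →
      ∀ a b c : ℕ, IsABCTriple a b c →
        (c : ℝ) < C * ((((∏ p ∈ S, p) *
          ∏ p ∈ (a * b * c).primeFactors \ S, p ^ (a * b * c).factorization p : ℕ) : ℝ)) ^ (1 + ε)) :
    ∀ ε : ℝ, 0 < ε → ∃ C : ℝ, 0 < C ∧ ∀ p q : ℕ, p.Prime → q.Prime → (q : ℤ) ^ 3 ≠ (p : ℤ) ^ 2 →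
      (q : ℝ) ^ ((1 : ℝ) / 2 - ε) ≤ C * |((q : ℝ) ^ 3 - (p : ℝ) ^ 2)| := by
  intro ε hε
  have hε'0 : (0 : ℝ) < min (ε / 3) (1 / 10) := lt_min (by linarith) (by norm_num)
  obtain ⟨C₀, hC₀, hh⟩ := h (min (ε / 3) (1 / 10)) hε'0
  refine ⟨max C₀ 1, lt_max_of_lt_right one_pos, ?_⟩
  intro p q hp hq hne
  have hC₁ : (1 : ℝ) ≤ max C₀ 1 := le_max_right _ _
  have hP : (1 : ℝ) ≤ p := by exact_mod_cast hp.one_lt.le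
  have hQ : (1 : ℝ) ≤ q := by exact_mod_cast hq.one_lt.le
  by_cases hpq : p = q
  · -- `p = q`: `|q³ − q²| = q²(q − 1) ≥ q ≥ q^{1/2 − ε}`.
    subst hpq
    have hp2 : (2 : ℝ) ≤ p := by exact_mod_cast hp.two_le
    have h0 : (0 : ℝ) ≤ ((p : ℝ) - 2) * ((p : ℝ) + 1) * (p : ℝ) :=
      mul_nonneg (mul_nonneg (by linarith) (by positivity)) (by positivity)
    have hcube : (p : ℝ) ≤ (p : ℝ) ^ 3 - (p : ℝ) ^ 2 := by nlinarith
    have h1 : (p : ℝ) ^ ((1 : ℝ) / 2 - ε) ≤ p := by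
      calc (p : ℝ) ^ ((1 : ℝ) / 2 - ε) ≤ (p : ℝ) ^ (1 : ℝ) :=
            Real.rpow_le_rpow_of_exponent_le hP (by linarith)
        _ = p := Real.rpow_one _
    rw [abs_of_nonneg (by linarith)]
    calc (p : ℝ) ^ ((1 : ℝ) / 2 - ε) ≤ (p : ℝ) ^ 3 - (p : ℝ) ^ 2 := h1.trans hcube
      _ = 1 * ((p : ℝ) ^ 3 - (p : ℝ) ^ 2) := (one_mul _).symm
      _ ≤ max C₀ 1 * ((p : ℝ) ^ 3 - (p : ℝ) ^ 2) :=
          mul_le_mul_of_nonneg_right hC₁ (by linarith)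
  · have hcop : Nat.Coprime p q := (Nat.coprime_primes hp hq).mpr hpq
    rcases lt_trichotomy (p ^ 2) (q ^ 3) with hlt | heq | hgt
    · -- `p² < q³`: feed `(p², q³ − p², q³)`.
      have hfeed := primeHall_feed hC₀ hε'0 hh hp hq hpq (pow_ne_zero 2 hp.ne_zero) hlt
        (Nat.Coprime.pow 2 3 hcop) (primeHall_primeFactors_pow_mul_pow hp hq 2 3)
      have hB : (1 : ℝ) ≤ ((q ^ 3 - p ^ 2 : ℕ) : ℝ) := by exact_mod_cast Nat.sub_pos_of_lt hlt
      have habs : |(q : ℝ) ^ 3 - (p : ℝ) ^ 2| = ((q ^ 3 - p ^ 2 : ℕ) : ℝ) := by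
        rw [Nat.cast_sub hlt.le, Nat.cast_pow, Nat.cast_pow]
        exact abs_of_nonneg (sub_nonneg.mpr (by exact_mod_cast hlt.le))
      rw [habs]
      refine primeHall_core hP hQ hB hC₀ hC₁ (le_max_left _ _) hε hε'0 (min_le_left _ _)
        (min_le_right _ _) (Or.inl ⟨?_, by exact_mod_cast hlt.le⟩)
      simpa only [Nat.cast_pow] using hfeed
    · exact absurd (by exact_mod_cast heq.symm) hne
    · -- `q³ < p²`: feed `(q³, p² − q³, p²)`.
      have hfeed := primeHall_feed hC₀ hε'0 hh hp hq hpq (pow_ne_zero 3 hq.ne_zero) hgt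
        (Nat.Coprime.pow 3 2 hcop.symm)
        (by rw [mul_comm]; exact primeHall_primeFactors_pow_mul_pow hp hq 2 3)
      have hB : (1 : ℝ) ≤ ((p ^ 2 - q ^ 3 : ℕ) : ℝ) := by exact_mod_cast Nat.sub_pos_of_lt hgt
      have habs : |(q : ℝ) ^ 3 - (p : ℝ) ^ 2| = ((p ^ 2 - q ^ 3 : ℕ) : ℝ) := by
        rw [abs_sub_comm, Nat.cast_sub hgt.le, Nat.cast_pow, Nat.cast_pow]
        exact abs_of_nonneg (sub_nonneg.mpr (by exact_mod_cast hgt.le))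
      rw [habs]
      refine primeHall_core hP hQ hB hC₀ hC₁ (le_max_left _ _) hε hε'0 (min_le_left _ _)
        (min_le_right _ _) (Or.inr ⟨?_, by exact_mod_cast hgt.le⟩)
      simpa only [Nat.cast_pow] using hfeed

end Summit.ABC.ABC.Theorems.UniformSadicTowerFour.MixedRadical
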